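import Literature.AlgebraicGeometry.Frobenioids.Cor54SubStrongUniqueReduction
import Literature.AlgebraicGeometry.Frobenioids.Cor54SubSquareCanonical
import Literature.AlgebraicGeometry.Frobenioids.ArithmeticFrobenioidStandard
import HarnessLib

/-!
# Frobenioids I, Corollary 5.4 at `C_{K/F}`: the strong 1-uniqueness clause and the realification clause
# AS PRINTED (sub-DAG row C54-core-arith, file 5b — modulo `hrig`)

Mochizuki, *The geometry of Frobenioids I: the general theory*, Kyushu J. Math. **62** (2008) 293–400,
Corollary 5.4 p. 104, at the arithmetic Frobenioids `C_{K/F}` of Example 6.3 / Theorem 6.4 pp. 113–116.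
[cite: MochizukiFrdI2008, Cor. 5.4 p.104]

PROOF-ONLY file (seat abc-iut-w5-d048, L1-lead R111 (2)/R125: sub-row (5); no definitions). From the rigidity
`hrig` of `C_{K/F}^un-tr → C_{K/F}^rlf` (every endofunctor `T` of `C_{K/F}^rlf` with `untrToRlf ⋙ T ≅ untrToRlf` is
`≅ 𝟭`):

* `FrdI.Cor54Sub.strongUnique_arith_of_rigid` — the **strong 1-uniqueness clause of Cor. 5.4 AS TYPED** at
  `C₁ = C_{K/F}`: for THE square (`Square`: `Ψ^istr`, comparison equivalences `e₁, e₂`, an equivalence `Ψ^rlf`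
  filling it), EVERY `Ψ'` filling the square is `≅ Ψ^rlf` (`strongUnique_of_rigidAlong_untrToRlf`);
* `FrdI.Cor54Sub.cor54_rlf_asPrinted_arith_of_rigid` — for `K/F` Galois (so that `C_{K/F}` IS a Frobenioid,
  Thm. 6.4 (i), `arithFrobenioid_isFrobenioid`) and every Cor. 4.11 package from `C_{K/F}` to a Frobenioid `C₂` over
  a perf-factorial divisor monoid: THERE EXISTS a `Ψ^rlf : C_{K/F}^rlf → C₂^rlf` 1-compatible with `Ψ^istr` (THE
  square at THE comparison equivalences `untrComparison`), it is an EQUIVALENCE, and EVERY 1-compatible `Ψ'` is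
  `≅ Ψ^rlf` — existence/equivalence/square from abc-iut-L1-t10's `exists_rlfTransport_square`, uniqueness WITHOUT
  the "induced" proviso from `hrig`.
Nothing here bears on [IUTchIII] Cor. 3.12.
-/

noncomputable section

namespace Literature.AlgebraicGeometry.Frobenioids

namespace FrdI.Cor54Sub

open CategoryTheory Opposite ModelFrobenioid

universe u₂' v₂' u₂ v₂

variable {F : Type} [Field F] [NumberField F] {K : Type} [Field K] [Algebra F K]
  (hΦ : PreFrobenioid.IsPerfFactorialOn (arithDivisorFunctor F K))

/-- **The strong 1-uniqueness clause of Cor. 5.4 AS TYPED at `C₁ = C_{K/F}`.**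
[cite: MochizukiFrdI2008, Cor. 5.4 p.104] -/
theorem strongUnique_arith_of_rigid
    (hrig : ∀ T : PreFrobenioid.rlf (ModelFrobenioid.toElem (arithDivisorFunctor F K) (unitsFunctor F K) (divNatTrans F K)) hΦ ⥤ PreFrobenioid.rlf (ModelFrobenioid.toElem (arithDivisorFunctor F K) (unitsFunctor F K) (divNatTrans F K)) hΦ,
      Nonempty ((PreFrobenioid.untrToRlf (ModelFrobenioid.toElem (arithDivisorFunctor F K) (unitsFunctor F K) (divNatTrans F K)) hΦ) ⋙ T ≅ (PreFrobenioid.untrToRlf (ModelFrobenioid.toElem (arithDivisorFunctor F K) (unitsFunctor F K) (divNatTrans F K)) hΦ)) → Nonempty (T ≅ 𝟭 _))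
    {D₂ : Type u₂'} [Category.{v₂'} D₂] {Φ₂ : D₂ᵒᵖ ⥤ CommMonCat.{0}}
    {C₂ : Type u₂} [Category.{v₂} C₂] {F₂ : C₂ ⥤ ElemFrobenioid Φ₂} (hΦ₂ : PreFrobenioid.IsPerfFactorialOn Φ₂)
    (Ψistr : (PreFrobenioidData.ofFunctor (arithDivisorFunctor F K) (ModelFrobenioid.toElem (arithDivisorFunctor F K) (unitsFunctor F K) (divNatTrans F K))).Istr ⥤ (PreFrobenioidData.ofFunctor Φ₂ F₂).Istr)
    (e₁ : (PreFrobenioidData.ofFunctor (arithDivisorFunctor F K) (ModelFrobenioid.toElem (arithDivisorFunctor F K) (unitsFunctor F K) (divNatTrans F K))).Untr ≌ PreFrobenioid.untrModel (ModelFrobenioid.toElem (arithDivisorFunctor F K) (unitsFunctor F K) (divNatTrans F K)))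
    (e₂ : (PreFrobenioidData.ofFunctor Φ₂ F₂).Untr ≌ PreFrobenioid.untrModel F₂)
    (Ψrlf : PreFrobenioid.rlf (ModelFrobenioid.toElem (arithDivisorFunctor F K) (unitsFunctor F K) (divNatTrans F K)) hΦ ⥤ PreFrobenioid.rlf F₂ hΦ₂) [Ψrlf.IsEquivalence]
    (hsq : Square hΦ hΦ₂ Ψistr e₁ e₂ Ψrlf)
    (Ψ' : PreFrobenioid.rlf (ModelFrobenioid.toElem (arithDivisorFunctor F K) (unitsFunctor F K) (divNatTrans F K)) hΦ ⥤ PreFrobenioid.rlf F₂ hΦ₂) (hsq' : Square hΦ hΦ₂ Ψistr e₁ e₂ Ψ') :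
    Nonempty (Ψ' ≅ Ψrlf) :=
  strongUnique_of_rigidAlong_untrToRlf hΦ hΦ₂ Ψistr e₁ e₂ Ψrlf hsq hrig Ψ' hsq'

/-- **Cor. 5.4, realification clause AS PRINTED, at `C₁ = C_{K/F}` (`K/F` Galois)**: for every Cor. 4.11
package, THERE EXISTS a 1-compatible `Ψ^rlf : C_{K/F}^rlf → C₂^rlf`, an EQUIVALENCE, and EVERY 1-compatible `Ψ'`
is `≅ Ψ^rlf`. [cite: MochizukiFrdI2008, Cor. 5.4 p.104] -/
theorem cor54_rlf_asPrinted_arith_of_rigid [IsGalois F K]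
    (hrig : ∀ T : PreFrobenioid.rlf (ModelFrobenioid.toElem (arithDivisorFunctor F K) (unitsFunctor F K) (divNatTrans F K)) hΦ ⥤ PreFrobenioid.rlf (ModelFrobenioid.toElem (arithDivisorFunctor F K) (unitsFunctor F K) (divNatTrans F K)) hΦ,
      Nonempty ((PreFrobenioid.untrToRlf (ModelFrobenioid.toElem (arithDivisorFunctor F K) (unitsFunctor F K) (divNatTrans F K)) hΦ) ⋙ T ≅ (PreFrobenioid.untrToRlf (ModelFrobenioid.toElem (arithDivisorFunctor F K) (unitsFunctor F K) (divNatTrans F K)) hΦ)) → Nonempty (T ≅ 𝟭 _))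
    {D₂ : Type u₂'} [Category.{v₂'} D₂] {Φ₂ : D₂ᵒᵖ ⥤ CommMonCat.{0}}
    {C₂ : Type u₂} [Category.{v₂} C₂] (F₂ : C₂ ⥤ ElemFrobenioid Φ₂) (hΦ₂ : PreFrobenioid.IsPerfFactorialOn Φ₂)
    (hF₂ : PreFrobenioid.IsFrobenioid F₂)
    (Ψ : arithFrobenioid F K ⥤ C₂)
    (Ψistr : (PreFrobenioidData.ofFunctor (arithDivisorFunctor F K) (ModelFrobenioid.toElem (arithDivisorFunctor F K) (unitsFunctor F K) (divNatTrans F K))).Istr ⥤ (PreFrobenioidData.ofFunctor Φ₂ F₂).Istr)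
    (hΨistr : Ψistr ⋙ (PreFrobenioidData.ofFunctor Φ₂ F₂).istrι ≅ (PreFrobenioidData.ofFunctor (arithDivisorFunctor F K) (ModelFrobenioid.toElem (arithDivisorFunctor F K) (unitsFunctor F K) (divNatTrans F K))).istrι ⋙ Ψ)
    (Ψuntr : (PreFrobenioidData.ofFunctor (arithDivisorFunctor F K) (ModelFrobenioid.toElem (arithDivisorFunctor F K) (unitsFunctor F K) (divNatTrans F K))).Untr ⥤ (PreFrobenioidData.ofFunctor Φ₂ F₂).Untr)
    (s : Ψistr ⋙ (PreFrobenioidData.ofFunctor Φ₂ F₂).toUntr ≅ (PreFrobenioidData.ofFunctor (arithDivisorFunctor F K) (ModelFrobenioid.toElem (arithDivisorFunctor F K) (unitsFunctor F K) (divNatTrans F K))).toUntr ⋙ Ψuntr)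
    (ΨBase : FinSubextCat F K ≌ D₂)
    (E : PreFrobenioidData.DivisorMonoidIsoOverBase (PreFrobenioidData.ofFunctor (arithDivisorFunctor F K) (ModelFrobenioid.toElem (arithDivisorFunctor F K) (unitsFunctor F K) (divNatTrans F K))) (PreFrobenioidData.ofFunctor Φ₂ F₂) ΨBase.functor)
    (η : Ψ ⋙ (PreFrobenioidData.ofFunctor Φ₂ F₂).base ≅ (PreFrobenioidData.ofFunctor (arithDivisorFunctor F K) (ModelFrobenioid.toElem (arithDivisorFunctor F K) (unitsFunctor F K) (divNatTrans F K))).base ⋙ ΨBase.functor)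
    (hdeg : ∀ ⦃A B : arithFrobenioid F K⦄ (φ : A ⟶ B),
      (PreFrobenioidData.ofFunctor Φ₂ F₂).degFr (Ψ.map φ) = (PreFrobenioidData.ofFunctor (arithDivisorFunctor F K) (ModelFrobenioid.toElem (arithDivisorFunctor F K) (unitsFunctor F K) (divNatTrans F K))).degFr φ)
    (hdiv : ∀ ⦃A B : arithFrobenioid F K⦄ (φ : A ⟶ B),
      (PreFrobenioidData.ofFunctor Φ₂ F₂).div (Ψ.map φ) =
        (PreFrobenioidData.ofFunctor Φ₂ F₂).pull (η.hom.app A) (E.iso ((PreFrobenioidData.ofFunctor (arithDivisorFunctor F K) (ModelFrobenioid.toElem (arithDivisorFunctor F K) (unitsFunctor F K) (divNatTrans F K))).base.obj A) ((PreFrobenioidData.ofFunctor (arithDivisorFunctor F K) (ModelFrobenioid.toElem (arithDivisorFunctor F K) (unitsFunctor F K) (divNatTrans F K))).div φ)))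
    (hbirat : BiratCompat (ModelFrobenioid.toElem (arithDivisorFunctor F K) (unitsFunctor F K) (divNatTrans F K)) F₂ ΨBase.functor E) :
    ∃ Ψrlf : PreFrobenioid.rlf (ModelFrobenioid.toElem (arithDivisorFunctor F K) (unitsFunctor F K) (divNatTrans F K)) hΦ ⥤ PreFrobenioid.rlf F₂ hΦ₂,
      Ψrlf.IsEquivalence ∧
        Square hΦ hΦ₂ Ψistr (PreFrobenioid.untrComparison (ModelFrobenioid.toElem (arithDivisorFunctor F K) (unitsFunctor F K) (divNatTrans F K)) (arithFrobenioid_isFrobenioid F K))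
          (PreFrobenioid.untrComparison F₂ hF₂) Ψrlf ∧
        ∀ Ψ' : PreFrobenioid.rlf (ModelFrobenioid.toElem (arithDivisorFunctor F K) (unitsFunctor F K) (divNatTrans F K)) hΦ ⥤ PreFrobenioid.rlf F₂ hΦ₂,
          Square hΦ hΦ₂ Ψistr (PreFrobenioid.untrComparison (ModelFrobenioid.toElem (arithDivisorFunctor F K) (unitsFunctor F K) (divNatTrans F K)) (arithFrobenioid_isFrobenioid F K))
            (PreFrobenioid.untrComparison F₂ hF₂) Ψ' → Nonempty (Ψ' ≅ Ψrlf) := by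
  obtain ⟨Ψrlf, hequiv, -, hsq, -⟩ := exists_rlfTransport_square (ModelFrobenioid.toElem (arithDivisorFunctor F K) (unitsFunctor F K) (divNatTrans F K)) hΦ F₂ hΦ₂
    (arithFrobenioid_isFrobenioid F K) hF₂ Ψ Ψistr hΨistr Ψuntr s ΨBase E η hdeg hdiv hbirat
  exact ⟨Ψrlf, hequiv, hsq, fun Ψ' hsq' =>
    strongUnique_of_rigidAlong_untrToRlf hΦ hΦ₂ Ψistr _ _ Ψrlf hsq hrig Ψ' hsq'⟩

end FrdI.Cor54Sub

end Literature.AlgebraicGeometry.Frobenioids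

end
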